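import Summits.CriticalPhenomena.CardyFormulaZ2.Theorems.CardyComplexConeEdgeCoherenceHarmonicSplit
import Literature.Probability.LatticeModels.MedialWindingBridge

/-!
# The harmonic split of `CardyComplexCone.EdgeCoherence`, part 2: what the route consumes

Companion of `Theorems/CardyComplexConeEdgeCoherenceHarmonicSplit.lean` (crux strategist
`planner-cstrat-stmt-CriticalPhenomena-11385-s1-0`, landed by the line lead `prover-line-stmt-CriticalPhenomena-11385-c2-0`
`--supports stmt-CriticalPhenomena-11385`). The proved crux `CoherentMorera` (stmt-CriticalPhenomena-11388) uses
`EdgeCoherence` only through mode selection (`ScaledNull P₀ ∨ ScaledNull P₂`); the alternating piece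
`AlternatingModeNull` of the split gives `ScaledNull P₂` directly (`ModeSelection.scaledNull_of_small`), hence BOTH
conclusions of `CoherentMorera` follow from `AlternatingModeNull` + `EdgePrecompact`, without the chiral mode
(`coherentMoreraConclusion_of_alternatingModeNull`; re-glue candidate for the tenure planner: `closes` on
`AlternatingModeNull`). `coherentMorera_of_alternatingModeNull` certifies that the conclusion IS `CoherentMorera`'s.

References: H. Duminil-Copin, S. Smirnov, *Conformal invariance of lattice models*, Clay Math. Proc. 15 (2012), §8
(Prop. 8.6, Conj. 8.7); H. Duminil-Copin, *Parafermionic observables and their applications*, arXiv:1208.3787, Prop. 4.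
-/

noncomputable section

namespace Summit.CriticalPhenomena.CardyFormulaZ2.Cruxes.EdgeCoherence.HarmonicSplit

open scoped BigOperators Topology
open Filter Set MeasureTheory
open Literature.Probability.LatticeModels Literature.Probability.RandomPlanarGeometry
open Literature.Probability.Percolation (BondConfig bondPercolation half)
open Summit.CriticalPhenomena.CardyFormulaZ2.Theses.CardyComplexCone (EdgeCoherence EdgePrecompact)
open Summit.CriticalPhenomena.CardyFormulaZ2.Cruxes.EdgeCoherence.FixedRadiusCut
  (cornerObs harmonic HarmonicVanishing)
open Summit.CriticalPhenomena.CardyFormulaZ2.Cruxes.CoherentMorera.FinitaryGreenPairing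
  (KirchhoffRel cornersAt Guards TestFn ScaledNull P0 P2 PV A2 del VertexPrecompactAt scaledNull_of_sub_of_or
   spinShift_of stub_pairingBound stub_kirchhoff stub_siteRegrouping stub_traceIdentity stub_precompactTransfer)
open Summit.CriticalPhenomena.CardyFormulaZ2.Cruxes.CoherentMorera.FinitaryGreenPairing.ModeSelection
  (exists_bound_dbar_del scaledNull_of_small)

/-! ## What the route consumes: the alternating mode alone feeds `CoherentMorera`'s conclusion

`CoherentMorera` (stmt-CriticalPhenomena-11388, proved) uses `EdgeCoherence` only through mode selection
(`ScaledNull P₀ ∨ ScaledNull P₂`); piece 2 gives `ScaledNull P₂` directly (`ModeSelection.scaledNull_of_small`),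
hence BOTH conclusions of `CoherentMorera` from `AlternatingModeNull` + `EdgePrecompact`, without the chiral
mode (re-glue candidate for the tenure planner: `closes` on `AlternatingModeNull`). -/

/-- `δ^{5/3} P₂ → 0` from the alternating mode (pointwise `o(δ^{1/3})` on `tsupport φ` + lattice-point count). -/
theorem scaledNull_P2_of_alternatingModeNull (h2 : AlternatingModeNull) (D : DobrushinDomain)
    (Λ : ℝ → DiscreteDobrushin) (hG : Guards D Λ) (φ : ℂ → ℂ) (hT : TestFn D φ) :
    ScaledNull (P2 Λ φ) := by
  obtain ⟨hΩ, hδ, hadm⟩ := hG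
  obtain ⟨hφ, hc, hsub⟩ := hT
  obtain ⟨B, hB0, -, hBl⟩ := exists_bound_dbar_del hφ hc
  have hK : Bornology.IsBounded (tsupport φ) := hc.isCompact.isBounded
  have hl0 : ∀ p, p ∉ tsupport φ → del φ p = 0 := fun p hp => by
    simp [del, fderiv_of_notMem_tsupport ℝ hp]
  refine scaledNull_of_small (ψ := del φ) hK hB0 (C := 1) zero_le_one hl0 hBl
    (a := fun δ v => A2 (Summit.CriticalPhenomena.CardyFormulaZ2.Cruxes.CoherentMorera.FinitaryGreenPairing.cornerObs Λ δ) v)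
    fun ε hε => ?_
  filter_upwards [h2 D Λ hΩ hδ hadm (tsupport φ) hc.isCompact hsub ε hε] with δ hA v hv
  -- buildfix 2026-08-20 (proof-only, regime-robust): read the route-side corner function through
  -- `fgpCornerObs_apply` (the two `winding` copies) instead of by `rfl`.
  rw [one_mul, show A2 (Summit.CriticalPhenomena.CardyFormulaZ2.Cruxes.CoherentMorera.FinitaryGreenPairing.cornerObs Λ δ) v =
      A2 (fun c => cornerObs (Λ δ) δ c.1 c.2) v from by simp only [A2, fgpCornerObs_apply]]
  exact hA v hv

/-- **`AlternatingModeNull → EdgePrecompact →` (both conclusions of `CoherentMorera`)** — weak holomorphy of the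
vertex observable on every family and its vertex precompactness — by the landed stubs of line
`finitary-green-pairing`; `EdgeCoherence` (hence the chiral mode) is not used.
[cite: DuminilCopinSmirnov2012Lattice, Conjecture 8.7] -/
theorem coherentMoreraConclusion_of_alternatingModeNull : AlternatingModeNull → EdgePrecompact →
    (∀ (D : DobrushinDomain) (Λ : ℝ → DiscreteDobrushin), (∀ δ, (Λ δ).Ω = D.carrier) →
        (∀ δ, (Λ δ).δ = δ) → (∀ᶠ δ in 𝓝[>] (0:ℝ), (Λ δ).IsZdAdmissible) →
          ∀ φ : ℂ → ℂ, ContDiff ℝ (⊤ : ℕ∞) φ → HasCompactSupport φ → tsupport φ ⊆ D.carrier →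
            ScaledNull (PV Λ φ)) ∧
      (∀ (D : DobrushinDomain) (Λ : ℝ → DiscreteDobrushin), (∀ δ, (Λ δ).Ω = D.carrier) →
        (∀ δ, (Λ δ).δ = δ) → (∀ᶠ δ in 𝓝[>] (0:ℝ), (Λ δ).IsZdAdmissible) → VertexPrecompactAt D Λ) := by
  intro h2 hP
  refine ⟨?_, ?_⟩
  · intro D Λ hΩ hδ hadm φ hφ hsupp hsub
    have hG : Guards D Λ := ⟨hΩ, hδ, hadm⟩
    have hT : TestFn D φ := ⟨hφ, hsupp, hsub⟩
    have h0 : ScaledNull (P0 Λ φ) :=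
      scaledNull_of_sub_of_or (spinShift_of stub_pairingBound stub_kirchhoff D Λ hG φ hT)
        (Or.inr (scaledNull_P2_of_alternatingModeNull h2 D Λ hG φ hT))
    exact (stub_siteRegrouping D Λ hG (stub_traceIdentity D Λ hG) φ hT).2 h0
  · intro D Λ hΩ hδ hadm
    exact stub_precompactTransfer hP D Λ ⟨hΩ, hδ, hadm⟩ (stub_traceIdentity D Λ ⟨hΩ, hδ, hadm⟩)

/-- Certificate: the conclusion above IS `CoherentMorera`'s (so `EdgeCoherence → EdgePrecompact → …` is recovered). -/
theorem coherentMorera_of_alternatingModeNull :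
    AlternatingModeNull → Summit.CriticalPhenomena.CardyFormulaZ2.Theses.CardyComplexCone.CoherentMorera := by
  intro h2 _ hP
  have h := coherentMoreraConclusion_of_alternatingModeNull h2 hP
  -- buildfix 2026-08-20 (proof-only, regime-robust): the route clause spells the fully-qualified
  -- `…LatticeModels.passageSum` (= `FermionicObservable`'s copy while that module carries one), the Defs'
  -- `vertexObs` the `MedialPath` copy; bridge them (`MedialWindingBridge`) unless they already coincide.
  first
    | exact h
    | (unfold PV VertexPrecompactAt ScaledNull
         Summit.CriticalPhenomena.CardyFormulaZ2.Cruxes.CoherentMorera.FinitaryGreenPairing.vertexObs at h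
       rw [Literature.Probability.LatticeModels.MedialPath.passageSum_eq_passageSum'] at h
       exact h)

end Summit.CriticalPhenomena.CardyFormulaZ2.Cruxes.EdgeCoherence.HarmonicSplit

end
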